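import Summits.QuantumAdvantage.QuantumAdvantage.Cruxes.PlLift.Lines.certified_canonical_lift
import Summits.QuantumAdvantage.QuantumAdvantage.Theorems.WhiteBoxWalkWbwThesis
import Summits.QuantumAdvantage.QuantumAdvantage.Theorems.WbwThesis.Negative.GuessingBound

/-!
# STUB-IDEAS k3 sketch — `stub_certified_thesis : WbwCertifiedThesis` (crux PlLift, stmt-QuantumAdvantage-0250)

Elaboration sanity for the helper-lemma statements of STUB-IDEAS-stub_certified_thesis-3.md
(planner-sidea-stmt-QuantumAdvantage-0250-stub_certified-3-0, 2026-08-16). Sorries only in the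
proposed helper lemmas; the two XS glue lemmas and the finite vote-rule certificate are proved.
-/

set_option linter.dupNamespace false

namespace Summit.QuantumAdvantage.QuantumAdvantage.Cruxes.PlLift.CertifiedCanonicalLift.StubIdeas3

open Literature.Computability.Complexity Literature.Computability.Cryptography
open _root_.Computability Polynomial Filter Asymptotics
open Summit.QuantumAdvantage.QuantumAdvantage.Theorems.WhiteBoxWalk (genPQ ansPQ bigProd factorCode)
open Summit.QuantumAdvantage.QuantumAdvantage.Theorems (FactoringAssumption)
open Summit.QuantumAdvantage.QuantumAdvantage.Theorems.WbwThesis.Negative (ClauseC)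

/-! ## Plan B (degenerate extreme `V ≡ true`): the certification slot is eliminable -/

/-- B1 (XS, proved): `X_pd → X_cert` with the trivial verifier. With `stub_certify` this makes the
stub EQUIVALENT to `WbwCanonicalThesis`. -/
theorem certified_of_canonical : WbwCanonicalThesis → WbwCertifiedThesis := by
  rintro ⟨gen, ans, a, p, hgen, hag, hlen, ⟨F, hF, hU, hQ⟩, hC⟩
  exact ⟨gen, ans, a, fun _ => true, p, hgen, const_mem_FP [true], fun _ => rfl, hag, hlen,
    ⟨F, hF, hU, fun x _ => hQ x⟩, hC⟩

/-- B2 (XS, proved): NORMAL FORM of the stub's content — a total map `a` of exact polynomial length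
that ONE uniform family writes canonically everywhere (`a`'s prefix relation `IsQSolvable`, i.e.
`a ∈ FBQP` up to padding) and that is planted-hard along a poly-time `gen` (`ClauseC gen (a ∘ gen)`)
IS a witness of `X_pd` (take `ans := a ∘ gen`). -/
theorem canonical_of_plantedFBQP {gen a : List Bool → List Bool} {p : Polynomial ℕ}
    (hgen : PolyTimeComputable id id gen) (hlen : ∀ x, (a x).length = p.eval x.length)
    (hQ : IsQSolvable fun x => {y | a x <+: y}) (hC : ClauseC gen fun s => a (gen s)) :
    WbwCanonicalThesis :=
  ⟨gen, fun s => a (gen s), a, p, hgen, fun _ => rfl, hlen, hQ, hC⟩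

/-! ## Plan A (perturbation of the PROVED neighbouring case `wbwThesis_of_factoringAssumption`) -/

/-- The everywhere-canonical answer map of Plan A: the code of the prime factorisation of
`decodeNat (h x)` (`h` = the FP extractor of `stub_extract`), cut or zero-padded to width exactly
`p(|x|)`. Total; `|aFac h p x| = p(|x|)`. -/
def aFac (h : List Bool → List Bool) (p : Polynomial ℕ) (x : List Bool) : List Bool :=
  (factorCode (decodeNat (h x))).takeD (p.eval x.length) false

@[simp] theorem length_aFac (h : List Bool → List Bool) (p : Polynomial ℕ) (x : List Bool) :
    (aFac h p x).length = p.eval x.length := by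
  simp [aFac]

/-- L1 (S): clause (C) for the line's OWN pair `(genPQ, ansPQ)` under the factoring assumption —
the second half of `stub_bridge` (truncation adversary + `isOneWay_genPQ`), extracted as a named
lemma (today it is only available packed inside the `∃` of `wbwThesis_of_factoringAssumption`). -/
theorem clauseC_ansPQ (hF : FactoringAssumption) : ClauseC genPQ ansPQ := by
  sorry

/-- L2 (S–M): TRANSPORT OF (C) ALONG FP POST-PROCESSING that may read the instance: if from any
string extending `ans' s` an FP map `f` (given the whole input `⟨1ⁿ, gen s⟩`) produces a string
extending `ans s`, then hardness of `ans` gives hardness of `ans'` (adversary `B.run z r :=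
f (boolPair z (A.run z r))`, same coins; pattern `GuessingBound.postCompose_isPPT` +
`pr_le_pr_of_imp` + `SuperpolynomialDecay.trans_abs_le`). -/
theorem clauseC_of_postFP {gen ans ans' : List Bool → List Bool} {f : List Bool → List Bool}
    (hf : f ∈ FP)
    (himp : ∀ (n : ℕ) (s o : List Bool), ans' s <+: o →
      ans s <+: f (boolPair (boolPair (unaryEncodeNat n) (gen s)) o)) :
    ClauseC gen ans → ClauseC gen ans' := by
  sorry

/-- L3 (M): CANONICAL CLASSICAL WRAP OF SHOR — for every FP pre-processor `h` and width polynomial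
`p`, ONE uniform oracle-free Clifford+T family writes `aFac h p x` first w.p. `≥ 2/3` on EVERY input
`x`: `factoring_mem_FBQP_holds` at `h x`, inside `isQSolvable_classicalWrap_dep h g⁺` with the FP
post-processor `g⁺ ⟨x, y⟩ := takeD (p |x|) (re-encode (parse y))`, which reads `y` only through its
self-delimited factor-code prefix (`Assemble.parse_rawE`, `Assemble.factorCode_eq`), hence is
CANONICAL on the `≥ 2/3` event; `kernelProb_mono`. -/
theorem isQSolvable_aFac {h : List Bool → List Bool} (hh : h ∈ FP) (p : Polynomial ℕ) :
    IsQSolvable fun x => {y | aFac h p x <+: y} := by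
  sorry

/-- L4 (S–M): the factor code of `bigProd w` FITS in polynomial width measured in `|genPQ w|`
(`bigProd w < 2^{n·T}` from `Extract.pOf_mul_qOf_lt`; a factor list of `N` has `≤ log₂ N` entries of
`≤ |N|` bits each; `|w| ≤ |genPQ w|`, `Canon.length_le_length_genPQ`). -/
theorem factorCode_bigProd_fits :
    ∃ p : Polynomial ℕ, ∀ w, (factorCode (bigProd w)).length ≤ p.eval (genPQ w).length := by
  sorry

/-- ASSEMBLY A (XS–S once L1–L4 are in): **the factoring assumption implies the stub**, with the
trivial verifier. `h, hspec` from `stub_extract`; `g, gspec` from `stub_assemble`; `p` from L4;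
`a := aFac h p`; (Q) everywhere = L3; (C) for `a ∘ genPQ` = L2 applied to L1 with
`f z := g (boolPair (sndF (fstF z)) (sndF z))` (on the image `aFac h p (genPQ w) = factorCode
(bigProd w) ++ 0…0` by `hspec` + L4, so `o ⊒ aFac … ⇒ o ⊒ factorCode (bigProd w) ⇒ g ⟨genPQ w, o⟩ =
ansPQ w` by `gspec`); `genPQ` poly-time = `(isOneWay_genPQ hF).1`; then B2 and B1. -/
theorem certified_of_factoringAssumption (hF : FactoringAssumption) : WbwCertifiedThesis := by
  sorry

/-- COROLLARY (minimal-counterexample reading): a refutation of the stub is a refutation of the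
factoring assumption (an average-case PPT factoring algorithm) — the stub is as irrefutable in the
tree as crux `WbwThesis` itself. -/
theorem not_factoringAssumption_of_not_certified (h : ¬ WbwCertifiedThesis) : ¬ FactoringAssumption :=
  fun hF => h (certified_of_factoringAssumption hF)

/-! ## Plan C (certified finite check): the §Engine's 2-of-3 vote rule is canonical -/

/-- Slot types of a verified instance: certified-genuine, certified-dead (EXIT-neighbourhood killed),
or UNcertified with an arbitrary but FIXED vote bit (deterministic vote queries). -/
inductive Slot
  | G
  | D
  | U (vote : Bool)
  deriving DecidableEq, Repr

instance : Fintype Slot :=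
  ⟨{Slot.G, Slot.D, Slot.U true, Slot.U false}, by intro x; cases x with | G => simp | D => simp | U b => cases b <;> simp⟩

/-- Certified slots are the NIWI-covered ones. -/
def Slot.certified : Slot → Bool
  | .G => true
  | .D => true
  | .U _ => false

/-- Local-consistency vote for the unique `f`-preimage `e` of the handle `y`: genuine slots vote 1
(EXIT's two children return it), dead slots vote 0 (children killed), uncertified slots vote their
fixed bit. -/
def Slot.vote : Slot → Bool
  | .G => true
  | .D => false
  | .U b => b

/-- Number of votes for `e` and number of certified slots of a 3-slot instance. -/
def votes (t : Fin 3 → Slot) : ℕ := (Finset.univ.filter fun i => (t i).vote = true).card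
def certs (t : Fin 3 → Slot) : ℕ := (Finset.univ.filter fun i => (t i).certified = true).card

/-- C1 (proved by `decide`, 64 cases): SOUNDNESS of the acceptance rule "`f v = y` and `≥ 2` votes":
on a verified instance (`≥ 2` certified slots) acceptance of `e` forces a certified-GENUINE slot,
i.e. a slot whose walk produces `e` w.h.p. — so the solver's output law is `e` w.p. `≥ 1 − 2⁻ⁿ` or
`⊥` w.p. `1`: canonical (the walk dichotomy of the line card, propositional skeleton). -/
theorem voteRule_sound : ∀ t : Fin 3 → Slot, 2 ≤ certs t → 2 ≤ votes t → ∃ i, t i = Slot.G := by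
  decide

/-- C2 (proved by `decide`): COMPLETENESS on honest instances — two genuine slots always reach the
vote threshold, whatever the third slot is. -/
theorem voteRule_complete : ∀ t : Fin 3 → Slot, t 0 = Slot.G → t 1 = Slot.G → 2 ≤ votes t := by
  decide

end Summit.QuantumAdvantage.QuantumAdvantage.Cruxes.PlLift.CertifiedCanonicalLift.StubIdeas3
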